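import Mathlib
import Summits.NavierStokesRegularity.OSWSelfSimilar.TypeIIInnerLimitMasterCore
import HarnessLib
/-!
# The Z1 inner-object master theorem on PRESCRIBED zoom data, and TYPE-II-MODULATED zoom data from the failure of
# velocity Type I (zone Z1 TEMPLATE §T1.2 modulation dictionary / §T1.4-I (I-2)–(I-5); kernel, unconditional)

HONEST FRAMING (cell ns-blowup GROUP B «PROFILE SEARCH», zone Z1; D-0035/D-0074): part XLII of the Z1 dictionary. Part
XXXIV (`innerObject_master_core`) CHOOSES its gauge N-a zoom data internally (`exists_meridional_zoom_data_of_unbounded`: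
near-maxima of the running supremum above an arbitrary sequence of large values). Everything after that first line of
its proof only uses the PROPERTIES of the data (`tₖ ∈ [T⋆/2, T⋆)`, `λₖ > 0 → 0`, `rₖ ≥ 0`, `λₖ‖u‖ ≤ 1` on `[0, tₖ]`,
`λₖ‖u(tₖ, rₖe₀ + zₖe₂)‖ → 1`). This part separates the two:

* `exists_zoom_data_of_not_typeI` — **TYPE-II-MODULATED ZOOM DATA.** If `u` is bounded on closed sub-slabs of
  `[0, T⋆)` and velocity Type I FAILS quantitatively — for every `N` some `(t, x) ∈ [0, T⋆) × ℝ³` has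
  `N < √(T⋆ − t)‖u(t, x)‖` (for an axisymmetric Leray–Hopf blow-up this is KNSS 2009, the tree's
  `not_isTypeIBlowup_of_isMaximalSmoothSolution`) — then the near-max construction of part XX, run above such points,
  yields zoom data with the additional property **`(T⋆ − tₖ)/λₖ² → ∞`**: the dimensionless distance of the vertex
  diverges, i.e. the velocity gauge `λₖ = 1/sup_{[0,tₖ]}‖u‖` is TYPE-II-MODULATED against the self-similar clock
  `√(T⋆ − tₖ)` (bookkeeping: `tₖ ≤ sₖ` and `λₖ⁻¹ ≥ ‖u(tₖ, xₖ)‖ ≥ ½ sup_{[0,sₖ]}‖u‖ ≥ ½‖u(sₖ, yₖ)‖`, so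
  `(T⋆ − tₖ)/λₖ² ≥ ¼ (T⋆ − sₖ)‖u(sₖ, yₖ)‖² > ¼Rₖ² → ∞`);
* `exists_meridional_zoom_data_of_not_typeI` — the same with the near-max points in the meridional half-plane
  (axisymmetric slices);
* `innerObject_master_core_of_zoomData` — **PART XXXIV ON PRESCRIBED DATA**: given ANY meridional zoom data with the
  five properties, the whole conclusion of `innerObject_master_core` holds ALONG A SUBSEQUENCE `ψ` of the given data
  (centres `cₖ`, near-max points `xₖ = r_{ψ k}e₀ + z_{ψ k}e₂`, `‖xₖ − cₖ‖ ≤ Dλ_{ψ k}`, one further subsequence `φ`, the KNSS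
  blow-up limit `W` with the Oseen identity, zoomed vorticity `→ curl W`, and EXACTLY ONE of (α)/(β) with every rider —
  the proof of part XXXIV verbatim from its second line).

Consumer: the crux-side deposit `…VorticityRateBlowupTypeIIGauge` (certificate class: along Type-II-modulated data the
(β) branch is impossible, so the inner object is the uniform stream — and such data always exist by KNSS).
**Nothing here asserts that a singular solution exists or that (AX-L) holds or fails.** «violates: n/a — dictionary»;
bears_on LADDER-NS N5/Z1 → N1 linear core / N0⁻. Author: ns-blowup-profile-eng-1 g11, 2026-08-27.
-/

open Real Filter Topology Set MeasureTheory Function Bornology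
open scoped ENNReal NNReal
open Literature.Analysis.FluidPDE

namespace Summit.NavierStokesRegularity.OSWSelfSimilar
namespace TypeIIModulationDictionary

section ZoomData

variable {T : ℝ} {u : ℝ → EuclideanSpace ℝ (Fin 3) → EuclideanSpace ℝ (Fin 3)}

/-- **Type-II-modulated N-a zoom data from the quantitative failure of velocity Type I** (the construction of KNSS 2009,
proof of Prop. 6.1, run above points where `√(T⋆ − t)‖u‖` is large). If `u` is bounded on every `[0, S] × ℝ³`,
`S < T⋆`, and for every `N` there are `t ∈ [0, T⋆)`, `x` with `N < √(T⋆ − t)‖u(t, x)‖`, then there are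
`tₖ ∈ [T⋆/2, T⋆)`, `xₖ`, `λₖ > 0` with `λₖ → 0`, `λₖ‖u(t, x)‖ ≤ 1` on `[0, tₖ] × ℝ³`, `λₖ‖u(tₖ, xₖ)‖ → 1`, AND
`(T⋆ − tₖ)/λₖ² → ∞`. [new here — dictionary] -/
theorem exists_zoom_data_of_not_typeI (hT : 0 < T)
    (hbdd : ∀ S < T, ∃ N : ℝ, 0 < N ∧ ∀ t ∈ Icc 0 S, ∀ x, ‖u t x‖ ≤ N)
    (hnI : ∀ N : ℝ, ∃ t ∈ Ico 0 T, ∃ x : EuclideanSpace ℝ (Fin 3), N < Real.sqrt (T - t) * ‖u t x‖) :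
    ∃ (tn lamn : ℕ → ℝ) (xn : ℕ → EuclideanSpace ℝ (Fin 3)),
      (∀ k, T / 2 ≤ tn k ∧ tn k < T) ∧ (∀ k, 0 < lamn k) ∧ Tendsto lamn atTop (𝓝 0) ∧
      (∀ k, ∀ t ∈ Icc 0 (tn k), ∀ x, lamn k * ‖u t x‖ ≤ 1) ∧
      Tendsto (fun k => lamn k * ‖u (tn k) (xn k)‖) atTop (𝓝 1) ∧
      Tendsto (fun k => (T - tn k) / lamn k ^ 2) atTop atTop := by
  obtain ⟨N₁, hN₁, hbN₁⟩ := hbdd (T / 2) (by linarith)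
  have hsT : 0 < Real.sqrt T := Real.sqrt_pos.2 hT
  -- the running supremum `Msup s = sup_{[0,s] × ℝ³} ‖u‖` for `s < T`
  set V : ℝ → Set ℝ := fun s => (fun q : ℝ × EuclideanSpace ℝ (Fin 3) => ‖u q.1 q.2‖) '' (Icc 0 s ×ˢ univ)
    with hV
  have hVne : ∀ s, 0 ≤ s → (V s).Nonempty := fun s hs =>
    ⟨_, ⟨(0, 0), ⟨⟨le_rfl, hs⟩, mem_univ _⟩, rfl⟩⟩
  have hVbdd : ∀ s < T, BddAbove (V s) := fun s hs => by
    obtain ⟨N, -, hbN⟩ := hbdd s hs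
    refine ⟨N, ?_⟩
    rintro r ⟨⟨t, x⟩, ⟨ht, -⟩, rfl⟩
    exact hbN t ht x
  have hle : ∀ s < T, ∀ t ∈ Icc 0 s, ∀ x, ‖u t x‖ ≤ sSup (V s) := fun s hs t ht x =>
    le_csSup (hVbdd s hs) ⟨(t, x), ⟨ht, mem_univ _⟩, rfl⟩
  -- step 1: points with `√(T − s k)‖u (s k) (y k)‖ > √T · R k`, `R k := (k+2)(N₁+1)`; then `‖u (s k) (y k)‖ > R k`
  set R : ℕ → ℝ := fun k => ((k : ℝ) + 2) * (N₁ + 1) with hR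
  have hRpos : ∀ k, 0 < R k := fun k => by positivity
  have hbig : ∀ k : ℕ, ∃ s ∈ Ico 0 T, ∃ y : EuclideanSpace ℝ (Fin 3),
      Real.sqrt T * R k < Real.sqrt (T - s) * ‖u s y‖ := fun k => hnI (Real.sqrt T * R k)
  choose s hs y hy using hbig
  have hsqle : ∀ k, Real.sqrt (T - s k) ≤ Real.sqrt T := fun k =>
    Real.sqrt_le_sqrt (by linarith [(hs k).1])
  have hsq0 : ∀ k, 0 < Real.sqrt (T - s k) := fun k => Real.sqrt_pos.2 (sub_pos.2 (hs k).2)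
  have hyR : ∀ k, R k < ‖u (s k) (y k)‖ := fun k => by
    by_contra hle'
    push Not at hle'
    have h1 : Real.sqrt (T - s k) * ‖u (s k) (y k)‖ ≤ Real.sqrt T * R k :=
      mul_le_mul (hsqle k) hle' (norm_nonneg _) hsT.le
    linarith [hy k]
  -- step 2: a near-maximum of `‖u‖` over `[0, s k] × ℝ³`
  have hM : ∀ k, 0 < sSup (V (s k)) := fun k =>
    (hRpos k).trans (lt_of_lt_of_le (hyR k) (hle (s k) (hs k).2 (s k) ⟨(hs k).1, le_rfl⟩ (y k)))
  have hnear : ∀ k : ℕ, ∃ t ∈ Icc 0 (s k), ∃ x : EuclideanSpace ℝ (Fin 3),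
      (1 - 1 / ((k : ℝ) + 2)) * sSup (V (s k)) < ‖u t x‖ := by
    intro k
    have hlt : (1 - 1 / ((k : ℝ) + 2)) * sSup (V (s k)) < sSup (V (s k)) := by
      have h2 : (0 : ℝ) < 1 / ((k : ℝ) + 2) := by positivity
      nlinarith [hM k]
    obtain ⟨r, ⟨⟨t, x⟩, ⟨ht, -⟩, rfl⟩, hr⟩ := exists_lt_of_lt_csSup (hVne (s k) (hs k).1) hlt
    exact ⟨t, ht, x, hr⟩
  choose tn htn xn hxn using hnear
  -- step 3: the scale `λ k = 1 / sup_{[0, t k]} ‖u‖`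
  have htT : ∀ k, tn k < T := fun k => (htn k).2.trans_lt (hs k).2
  have hhalf : ∀ k : ℕ, (1 : ℝ) / 2 ≤ 1 - 1 / ((k : ℝ) + 2) := fun k => by
    have : (1 : ℝ) / ((k : ℝ) + 2) ≤ 1 / 2 := by
      rw [div_le_div_iff₀ (by positivity) (by positivity)]; linarith
    linarith
  have hM' : ∀ k, 0 < sSup (V (tn k)) := by
    intro k
    have h1 : 0 < (1 - 1 / ((k : ℝ) + 2)) * sSup (V (s k)) := mul_pos (by linarith [hhalf k]) (hM k)
    exact h1.trans ((hxn k).trans_le (hle (tn k) (htT k) (tn k) ⟨(htn k).1, le_rfl⟩ (xn k)))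
  set lamn : ℕ → ℝ := fun k => (sSup (V (tn k)))⁻¹ with hlamn
  -- the value at the chosen point dominates `R k / 2` and is within the factor of the running sup
  have hval_ge : ∀ k : ℕ, (1 - 1 / ((k : ℝ) + 2)) * sSup (V (tn k)) ≤ ‖u (tn k) (xn k)‖ := fun k => by
    have hmono : sSup (V (tn k)) ≤ sSup (V (s k)) :=
      csSup_le_csSup (hVbdd (s k) (hs k).2) (hVne (tn k) (htn k).1)
        (image_mono (prod_mono (Icc_subset_Icc_right (htn k).2) Subset.rfl))
    have hc : 0 ≤ 1 - 1 / ((k : ℝ) + 2) := by linarith [hhalf k]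
    exact (mul_le_mul_of_nonneg_left hmono hc).trans (hxn k).le
  have hval_le : ∀ k, ‖u (tn k) (xn k)‖ ≤ sSup (V (tn k)) := fun k =>
    hle (tn k) (htT k) (tn k) ⟨(htn k).1, le_rfl⟩ (xn k)
  have hval_half : ∀ k, ‖u (s k) (y k)‖ / 2 ≤ ‖u (tn k) (xn k)‖ := fun k => by
    have h2 : ‖u (s k) (y k)‖ ≤ sSup (V (s k)) := hle (s k) (hs k).2 (s k) ⟨(hs k).1, le_rfl⟩ (y k)
    have h3 : (1 : ℝ) / 2 * ‖u (s k) (y k)‖ ≤ (1 - 1 / ((k : ℝ) + 2)) * sSup (V (s k)) :=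
      mul_le_mul (hhalf k) h2 (norm_nonneg _) (by linarith [hhalf k])
    linarith [hxn k]
  have hval_big : ∀ k, R k / 2 < ‖u (tn k) (xn k)‖ := fun k => by
    linarith [hval_half k, hyR k]
  refine ⟨tn, lamn, xn, fun k => ⟨?_, htT k⟩, fun k => inv_pos.2 (hM' k), ?_, fun k t ht x => ?_, ?_, ?_⟩
  · -- `tn k ≥ T/2`: otherwise `‖u (tn k) (xn k)‖ ≤ N₁ < R k / 2`
    by_contra hlt
    push Not at hlt
    have h1 := hbN₁ (tn k) ⟨(htn k).1, hlt.le⟩ (xn k)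
    have h2 : N₁ < R k / 2 := by
      have hk0 : (0 : ℝ) ≤ (k : ℝ) := Nat.cast_nonneg k
      show N₁ < ((k : ℝ) + 2) * (N₁ + 1) / 2
      nlinarith [hN₁, hk0]
    linarith [hval_big k]
  · -- `λ k → 0`: `λ k ≤ 1 / ‖u (tn k) (xn k)‖ < 2 / R k → 0`
    have hR_top : Tendsto R atTop atTop := by
      refine Filter.Tendsto.atTop_mul_const (by linarith) ?_
      exact tendsto_natCast_atTop_atTop.atTop_add tendsto_const_nhds
    have h2R : Tendsto (fun k => 2 / R k) atTop (𝓝 0) := tendsto_const_nhds.div_atTop hR_top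
    refine squeeze_zero (fun k => (inv_pos.2 (hM' k)).le) (fun k => ?_) h2R
    have hv : 0 < ‖u (tn k) (xn k)‖ := (half_pos (hRpos k)).trans (hval_big k)
    calc lamn k = (sSup (V (tn k)))⁻¹ := rfl
      _ ≤ (‖u (tn k) (xn k)‖)⁻¹ := inv_anti₀ hv (hval_le k)
      _ ≤ 2 / R k := by
          rw [inv_eq_one_div, div_le_div_iff₀ hv (hRpos k)]
          linarith [hval_big k]
  · -- the gauge bound on `[0, tn k]`
    have h := hle (tn k) (htT k) t ht x
    calc lamn k * ‖u t x‖ ≤ lamn k * sSup (V (tn k)) :=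
          mul_le_mul_of_nonneg_left h (inv_pos.2 (hM' k)).le
      _ = 1 := inv_mul_cancel₀ (hM' k).ne'
  · -- `λ k ‖u (tn k) (xn k)‖ → 1`: squeezed between `1 - 1/(k+2)` and `1`
    have hlow : ∀ k : ℕ, 1 - 1 / ((k : ℝ) + 2) ≤ lamn k * ‖u (tn k) (xn k)‖ := fun k => by
      have h := mul_le_mul_of_nonneg_left (hval_ge k) (inv_pos.2 (hM' k)).le
      calc 1 - 1 / ((k : ℝ) + 2) = (sSup (V (tn k)))⁻¹ * ((1 - 1 / ((k : ℝ) + 2)) * sSup (V (tn k))) := by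
            rw [mul_comm (1 - 1 / ((k : ℝ) + 2)) (sSup (V (tn k))), inv_mul_cancel_left₀ (hM' k).ne']
        _ ≤ lamn k * ‖u (tn k) (xn k)‖ := h
    have hup : ∀ k, lamn k * ‖u (tn k) (xn k)‖ ≤ 1 := fun k => by
      calc lamn k * ‖u (tn k) (xn k)‖ ≤ lamn k * sSup (V (tn k)) :=
            mul_le_mul_of_nonneg_left (hval_le k) (inv_pos.2 (hM' k)).le
        _ = 1 := inv_mul_cancel₀ (hM' k).ne'
    have hlim : Tendsto (fun k : ℕ => 1 - 1 / ((k : ℝ) + 2)) atTop (𝓝 1) := by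
      have h : Tendsto (fun k : ℕ => 1 / ((k : ℝ) + 2)) atTop (𝓝 0) :=
        tendsto_const_nhds.div_atTop (tendsto_natCast_atTop_atTop.atTop_add tendsto_const_nhds)
      simpa using (tendsto_const_nhds (x := (1 : ℝ))).sub h
    exact tendsto_of_tendsto_of_tendsto_of_le_of_le hlim tendsto_const_nhds hlow hup
  · -- `(T − tn k)/λ k² → ∞`: `(T − tn k) · sup² ≥ (T − s k) ‖u (tn k) (xn k)‖² ≥ ¼ (T − s k)‖u (s k) (y k)‖² > ¼ T R k²`
    have hRsq_top : Tendsto (fun k => T * R k ^ 2 / 4) atTop atTop := by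
      have hR_top : Tendsto R atTop atTop := by
        refine Filter.Tendsto.atTop_mul_const (by linarith) ?_
        exact tendsto_natCast_atTop_atTop.atTop_add tendsto_const_nhds
      have h2 : Tendsto (fun k => R k ^ 2) atTop atTop := (tendsto_pow_atTop two_ne_zero).comp hR_top
      exact (h2.const_mul_atTop hT).atTop_div_const (by norm_num)
    refine tendsto_atTop_mono (fun k => ?_) hRsq_top
    have hl : 0 < lamn k := inv_pos.2 (hM' k)
    have hTs : 0 ≤ T - s k := (sub_pos.2 (hs k).2).le
    have hTt : T - s k ≤ T - tn k := by linarith [(htn k).2]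
    -- `(√(T − s k)‖u (s k) (y k)‖)² > T R k²`
    have h1 : T * R k ^ 2 < (T - s k) * ‖u (s k) (y k)‖ ^ 2 := by
      have h := hy k
      have h0 : 0 ≤ Real.sqrt T * R k := by positivity
      calc T * R k ^ 2 = (Real.sqrt T * R k) ^ 2 := by rw [mul_pow (Real.sqrt T) (R k), Real.sq_sqrt hT.le]
        _ < (Real.sqrt (T - s k) * ‖u (s k) (y k)‖) ^ 2 := pow_lt_pow_left₀ h h0 two_ne_zero
        _ = (T - s k) * ‖u (s k) (y k)‖ ^ 2 := by
            rw [mul_pow (Real.sqrt (T - s k)) (‖u (s k) (y k)‖), Real.sq_sqrt hTs]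
    -- `‖u (s k) (y k)‖² ≤ 4 ‖u (tn k) (xn k)‖² ≤ 4 sup²  = 4 / λ k²`
    have h2 : ‖u (s k) (y k)‖ ^ 2 ≤ 4 * (lamn k)⁻¹ ^ 2 := by
      have h3 : ‖u (s k) (y k)‖ ≤ 2 * (lamn k)⁻¹ := by
        have : (lamn k)⁻¹ = sSup (V (tn k)) := inv_inv _
        rw [this]; linarith [hval_half k, hval_le k]
      have h4 := pow_le_pow_left₀ (norm_nonneg _) h3 2
      nlinarith [h4]
    rw [le_div_iff₀ (pow_pos hl 2)]
    have hlinv : (lamn k)⁻¹ ^ 2 * lamn k ^ 2 = 1 := by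
      rw [← mul_pow, inv_mul_cancel₀ hl.ne', one_pow]
    calc T * R k ^ 2 / 4 * lamn k ^ 2 = (T * R k ^ 2) * lamn k ^ 2 / 4 := by ring
      _ ≤ ((T - s k) * ‖u (s k) (y k)‖ ^ 2) * lamn k ^ 2 / 4 := by
          gcongr
      _ ≤ ((T - tn k) * (4 * (lamn k)⁻¹ ^ 2)) * lamn k ^ 2 / 4 := by
          have hm : (T - s k) * ‖u (s k) (y k)‖ ^ 2 ≤ (T - tn k) * (4 * (lamn k)⁻¹ ^ 2) :=
            mul_le_mul hTt h2 (sq_nonneg _) (by linarith)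
          have hm' := mul_le_mul_of_nonneg_right hm (sq_nonneg (lamn k))
          linarith
      _ = T - tn k := by
          calc ((T - tn k) * (4 * (lamn k)⁻¹ ^ 2)) * lamn k ^ 2 / 4
              = (T - tn k) * ((lamn k)⁻¹ ^ 2 * lamn k ^ 2) := by ring
            _ = T - tn k := by rw [hlinv, mul_one]

/-- **Type-II-modulated MERIDIONAL zoom data** for an axisymmetric `u`: as in `exists_zoom_data_of_not_typeI`, with the
near-max points `rₖ e₀ + zₖ e₂`, `rₖ ≥ 0`, in the meridional half-plane (rotate by `IsAxisymmetric.norm_rotZ_apply`).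
[new here — dictionary] -/
theorem exists_meridional_zoom_data_of_not_typeI (hT : 0 < T) (haxi : ∀ t, IsAxisymmetric (u t))
    (hbdd : ∀ S < T, ∃ N : ℝ, 0 < N ∧ ∀ t ∈ Icc 0 S, ∀ x, ‖u t x‖ ≤ N)
    (hnI : ∀ N : ℝ, ∃ t ∈ Ico 0 T, ∃ x : EuclideanSpace ℝ (Fin 3), N < Real.sqrt (T - t) * ‖u t x‖) :
    ∃ (tn lamn rn zn : ℕ → ℝ),
      (∀ k, T / 2 ≤ tn k ∧ tn k < T) ∧ (∀ k, 0 < lamn k) ∧ Tendsto lamn atTop (𝓝 0) ∧ (∀ k, 0 ≤ rn k) ∧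
      (∀ k, ∀ t ∈ Icc 0 (tn k), ∀ x, lamn k * ‖u t x‖ ≤ 1) ∧
      Tendsto (fun k => lamn k *
        ‖u (tn k) (EuclideanSpace.single 0 (rn k) + EuclideanSpace.single 2 (zn k))‖) atTop (𝓝 1) ∧
      Tendsto (fun k => (T - tn k) / lamn k ^ 2) atTop atTop := by
  obtain ⟨tn, lamn, xn, htn, hlam, hlam0, hgauge, hnear, hII⟩ := exists_zoom_data_of_not_typeI hT hbdd hnI
  choose θ hθ using fun k => exists_rotZ_eq_meridional (xn k)
  refine ⟨tn, lamn, fun k => cylRadius (xn k), fun k => xn k 2, htn, hlam, hlam0,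
    fun k => cylRadius_nonneg _, hgauge, hnear.congr fun k => ?_, hII⟩
  simp only
  rw [← hθ k, (haxi _).norm_rotZ_apply]

end ZoomData

section MasterCoreZoomData

variable {T Mₛ : ℝ} {u : ℝ → EuclideanSpace ℝ (Fin 3) → EuclideanSpace ℝ (Fin 3)}
  {p : ℝ → EuclideanSpace ℝ (Fin 3) → ℝ}

/-- **THE Z1 INNER-OBJECT MASTER THEOREM — ANALYTIC CORE ON PRESCRIBED MERIDIONAL ZOOM DATA (unconditional).**
Hypotheses: `(u, p)` classical (`ν = 1`, unforced) on `[0, T⋆) × ℝ³`, `T⋆ > 0`, axisymmetric slices, energy and sup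
bounds on every closed sub-slab, `|Γ(0, ·)| ≤ Mₛ`; and meridional zoom data `tₖ ∈ [T⋆/2, T⋆)`, `λₖ > 0 → 0`, `rₖ ≥ 0`,
`λₖ‖u‖ ≤ 1` on `[0, tₖ]`, `λₖ‖u(tₖ, rₖe₀ + zₖe₂)‖ → 1`. Conclusion: `tₖ → T⋆`, and ALONG A SUBSEQUENCE `ψ` of the given
data — centres `cₖ`, near-max points `xₖ := r_{ψ k}e₀ + z_{ψ k}e₂` with `‖xₖ − cₖ‖ ≤ Dλ_{ψ k}`, ONE further subsequence `φ`
— the zoom converges to a KNSS blow-up limit `W` (with the Oseen identity), the zoomed vorticity converges to `curl W`,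
and EXACTLY ONE of (α) `W ≡ c`, `‖c‖ = 1`, `c₁ = 0`, zoomed vorticity `→ 0`; (β) centres on the axis, `W` refutes
`AxisymmetricLiouvilleBoundedSwirl` with every (I-5) rider of part XXXIV. (Part XXXIV's proof verbatim, with the data
given instead of chosen.) [new here — dictionary; unconditional] -/
theorem innerObject_master_core_of_zoomData (hT : 0 < T) (hu : IsClassicalNSSolutionOn (Ico 0 T) 1 0 u p)
    (haxi : ∀ t, IsAxisymmetric (u t))
    (hE : ∀ S < T, ∃ C : ℝ≥0∞, C < ⊤ ∧ ∀ t ∈ Icc 0 S, ∫⁻ x, ‖u t x‖ₑ ^ 2 ≤ C)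
    (hbdd : ∀ S < T, ∃ N : ℝ, 0 < N ∧ ∀ t ∈ Icc 0 S, ∀ x, ‖u t x‖ ≤ N) (hMₛ : ∀ x, |swirl (u 0) x| ≤ Mₛ)
    {tn lamn rn zn : ℕ → ℝ} (htn : ∀ k, T / 2 ≤ tn k ∧ tn k < T) (hlam : ∀ k, 0 < lamn k)
    (hlam0 : Tendsto lamn atTop (𝓝 0)) (hrn : ∀ k, 0 ≤ rn k)
    (hgauge : ∀ k, ∀ t ∈ Icc 0 (tn k), ∀ x, lamn k * ‖u t x‖ ≤ 1)
    (hnear : Tendsto (fun k => lamn k *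
      ‖u (tn k) (EuclideanSpace.single 0 (rn k) + EuclideanSpace.single 2 (zn k))‖) atTop (𝓝 1)) :
    Tendsto tn atTop (𝓝 T) ∧
    ∃ (ψ : ℕ → ℕ) (cn : ℕ → EuclideanSpace ℝ (Fin 3)) (φ : ℕ → ℕ)
      (W : ℝ → EuclideanSpace ℝ (Fin 3) → EuclideanSpace ℝ (Fin 3)),
      StrictMono ψ ∧
      (∃ D : ℝ, ∀ k, ‖(EuclideanSpace.single 0 (rn (ψ k)) + EuclideanSpace.single 2 (zn (ψ k)) :
        EuclideanSpace ℝ (Fin 3)) - cn k‖ ≤ D * lamn (ψ k)) ∧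
      StrictMono φ ∧ IsKNSSBlowupLimit W ∧
      (∀ s < 0, TendstoLocallyUniformly
        (fun k => (lamn (ψ (φ k)) • stPull (lamn (ψ (φ k)) ^ 2) (lamn (ψ (φ k))) (tn (ψ (φ k))) (cn (φ k)) u) s)
          (W s) atTop) ∧
      (∀ s t : ℝ, s < t → t < 0 → ∀ x,
        W t x = Literature.Analysis.UnboundedOperators.heatExtension (W s) (t - s) x - oseenDuhamel 1 s W W t x) ∧
      (∀ s < 0, ∀ y : EuclideanSpace ℝ (Fin 3), Tendsto (fun j => lamn (ψ (φ j)) ^ 2 •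
        curl (u (tn (ψ (φ j)) + lamn (ψ (φ j)) ^ 2 * s)) (cn (φ j) + lamn (ψ (φ j)) • y)) atTop
          (𝓝 (curl (W s) y))) ∧
      (((∃ c : EuclideanSpace ℝ (Fin 3), ‖c‖ = 1 ∧ c 1 = 0 ∧ ∀ s < 0, ∀ y : EuclideanSpace ℝ (Fin 3), W s y = c) ∧
          ∀ s < 0, ∀ y : EuclideanSpace ℝ (Fin 3), Tendsto (fun j => lamn (ψ (φ j)) ^ 2 •
            curl (u (tn (ψ (φ j)) + lamn (ψ (φ j)) ^ 2 * s)) (cn (φ j) + lamn (ψ (φ j)) • y)) atTop (𝓝 0)) ∨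
        ((∀ k, cn k 0 = 0 ∧ cn k 1 = 0) ∧
          ¬ Summit.NavierStokesRegularity.NavierStokesRegularity.AxisymmetricLiouvilleBoundedSwirl ∧
          (∀ s < 0, IsAxisymmetric (W s)) ∧ (∀ s < 0, ∀ y : EuclideanSpace ℝ (Fin 3), |swirl (W s) y| ≤ Mₛ) ∧
          (∃ s < 0, ∃ x : EuclideanSpace ℝ (Fin 3), W s x ≠ W s 0) ∧
          (∃ s < 0, ∃ y : EuclideanSpace ℝ (Fin 3), curl (W s) y ≠ 0) ∧
          (∃ s < 0, ∃ y : EuclideanSpace ℝ (Fin 3), swirl (W s) y ≠ 0 ∧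
            Tendsto (fun k => swirl (u (tn (ψ (φ k)) + lamn (ψ (φ k)) ^ 2 * s)) (cn (φ k) + lamn (ψ (φ k)) • y))
              atTop (𝓝 (swirl (W s) y))) ∧
          (∀ C : ℝ, ∃ s < 0, ∃ x : EuclideanSpace ℝ (Fin 3), C < cylRadius x * ‖poloidalPart (W s) x‖) ∧
          (∀ c C : ℝ, ∃ s < 0, ∃ x : EuclideanSpace ℝ (Fin 3), C < cylRadius x * ‖poloidalPart (W s) x - c • eZ‖) ∧
          (∀ q : ℝ≥0∞, 1 ≤ q → q < ⊤ → ∀ K : ℝ≥0, ∃ s < 0, (K : ℝ≥0∞) < eLpNorm (swirl (W s)) q volume) ∧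
          (∃ ε : ℝ, 0 < ε ∧ ∀ R : ℝ, ∃ s < 0, ∃ x : EuclideanSpace ℝ (Fin 3),
            R ≤ cylRadius x ∧ ε < |swirl (W s) x|) ∧
          ∃ ε₀ ∈ Set.Ioo (0 : ℝ) 1, ∀ L R₀ : ℝ, ∃ s < 0, ∃ x : EuclideanSpace ℝ (Fin 3),
            R₀ ≤ cylRadius x ∧ ε₀ * L ^ 2 / cylRadius x < |swirl (W s) x ^ 2 - L ^ 2|)) := by
  have hT2 : 0 < T / 2 := by positivity
  -- the near-max points and `tₖ → T⋆`
  set xn : ℕ → EuclideanSpace ℝ (Fin 3) := fun k => EuclideanSpace.single 0 (rn k) + EuclideanSpace.single 2 (zn k)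
    with hxn
  have htT : Tendsto tn atTop (𝓝 T) :=
    tendsto_tn_of_zoom_data hbdd (xn := xn) (fun k => ⟨hT2.le.trans (htn k).1, (htn k).2⟩) hlam hlam0 hnear
  refine ⟨htT, ?_⟩
  by_cases hbA : BddAbove (Set.range fun k => rn k / lamn k)
  · -- ### Case A along a subsequence: axis-centred zoom
    obtain ⟨C, hC⟩ := hbA
    have hCk : ∀ k, rn k ≤ C * lamn k := fun k => by
      have h := hC ⟨k, rfl⟩
      simp only at h
      rwa [div_le_iff₀ (hlam k)] at h
    obtain ⟨d, -, ψ, hψ, hd⟩ := tendsto_subseq_of_bounded (Metric.isBounded_Icc (0 : ℝ) C)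
      (x := fun k => rn k / lamn k) fun k => ⟨div_nonneg (hrn k) (hlam k).le, hC ⟨k, rfl⟩⟩
    obtain ⟨φ₁, W, hφ₁, hW, hconv₁, hax, hsw⟩ :=
      innerLimit_caseA_data_standing hT hu haxi hE hbdd hMₛ
        (tn := tn ∘ ψ) (lamn := lamn ∘ ψ) (rn := rn ∘ ψ) (zn := zn ∘ ψ) hT2 (fun k => htn (ψ k))
        (fun k => hlam (ψ k)) (hlam0.comp hψ.tendsto_atTop) (fun k => hgauge (ψ k))
        (hnear.comp hψ.tendsto_atTop) hd
    -- refine so that the vorticities converge too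
    obtain ⟨ψ₂, hψ₂, hcurl⟩ := zoom_limit_curl_tendsto hu hE hbdd (tn := tn ∘ ψ) (lamn := lamn ∘ ψ)
      (xn := fun k => EuclideanSpace.single 2 (zn (ψ k))) hT2 (fun k => htn (ψ k)) (fun k => hlam (ψ k))
      (hlam0.comp hψ.tendsto_atTop) (fun k => hgauge (ψ k)) hφ₁ hconv₁
    set φ : ℕ → ℕ := φ₁ ∘ ψ₂ with hφdef
    have hφ : StrictMono φ := hφ₁.comp hψ₂
    have hconv : ∀ s < 0, TendstoLocallyUniformly (fun k => ((lamn ∘ ψ) (φ k) •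
        stPull ((lamn ∘ ψ) (φ k) ^ 2) ((lamn ∘ ψ) (φ k)) ((tn ∘ ψ) (φ k)) (EuclideanSpace.single 2 (zn (ψ (φ k)))) u) s)
        (W s) atTop := fun s hs => tendstoLocallyUniformly_subseq (hconv₁ s hs) hψ₂
    have hmild := zoom_limit_oseenIdentity hu hE hbdd (tn := tn ∘ ψ) (lamn := lamn ∘ ψ)
      (xn := fun k => EuclideanSpace.single 2 (zn (ψ k))) hT2 (fun k => htn (ψ k)) (fun k => hlam (ψ k))
      (hlam0.comp hψ.tendsto_atTop) (fun k => hgauge (ψ k)) hφ hW.smooth.continuousOn hconv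
    have hcax : ∀ k, (EuclideanSpace.single 2 (zn (ψ k)) : EuclideanSpace ℝ (Fin 3)) 0 = 0 ∧
        (EuclideanSpace.single 2 (zn (ψ k)) : EuclideanSpace ℝ (Fin 3)) 1 = 0 := fun k => by simp
    have hdist : ∃ D : ℝ, ∀ k, ‖xn (ψ k) - EuclideanSpace.single 2 (zn (ψ k))‖ ≤ D * (lamn ∘ ψ) k :=
      ⟨C, fun k => by
        rw [hxn, norm_meridional_sub_axisPoint, abs_of_nonneg (hrn (ψ k))]
        exact hCk (ψ k)⟩
    refine ⟨ψ, fun k => EuclideanSpace.single 2 (zn (ψ k)), φ, W, hψ, hdist, hφ, hW, hconv, hmild, hcurl, ?_⟩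
    by_cases hnc : ∃ s < 0, ∃ x : EuclideanSpace ℝ (Fin 3), W s x ≠ W s 0
    · -- (β) with every rider
      have hsw' : ∃ C : ℝ, ∀ s < 0, ∀ x, |swirl (W s) x| ≤ C := ⟨Mₛ, hsw⟩
      have hnc' : ∃ s < 0, ∃ x y : EuclideanSpace ℝ (Fin 3), W s x ≠ W s y := by
        obtain ⟨s, hs, x, hx⟩ := hnc
        exact ⟨s, hs, x, 0, hx⟩
      obtain ⟨s, hs, y, hy⟩ := typeBeta_exists_swirl_ne_zero hW hax hnc
      obtain ⟨ε₀, hε₀, hrate⟩ := typeBeta_not_swirl_rate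
      exact Or.inr ⟨hcax, not_axisymmetricLiouville_of_innerLimit_typeBeta hW hax hsw' hnc, hax, hsw, hnc,
        (knssBlowupLimit_typeBeta_iff_exists_curl_ne_zero hW).1 hnc,
        ⟨s, hs, y, hy, swirl_innerLimit_tendsto hcax hconv s hs y⟩, knssBlowupLimit_VCR_poloidal hW hax hsw',
        fun c C => hW.exists_lt_cylRadius_mul_norm_poloidal_sub_smul_eZ hax hsw' hnc' c C,
        fun q hq1 hq K => typeBeta_eLpNorm_swirl_unbounded hW hax hnc hq1 hq K,
        typeBeta_swirl_not_decay hW hax hnc, ε₀, hε₀, hrate W hW hax hsw' hnc⟩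
    · -- (α): axial unit stream, vorticity → 0
      push Not at hnc
      obtain ⟨β, hβ, hWβ⟩ := innerLimit_axialUnitStream_of_const hW hmild hax hnc
      refine Or.inl ⟨⟨β • eZ, ?_, by simp [eZ], hWβ⟩, fun s hs y => ?_⟩
      · rw [norm_smul, Real.norm_eq_abs, hβ]
        simp [eZ]
      · have hcs : W s = fun _ => β • eZ := funext (hWβ s hs)
        have h0 : curl (W s) y = 0 := by rw [hcs, curl_eq_curlCLM, fderiv_const_apply, map_zero]
        simpa [h0, hφdef, Function.comp_apply] using hcurl s hs y
  · -- ### Case B along a subsequence: (α); the centre IS the near-max point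
    obtain ⟨ψ, hψ, hd⟩ := exists_subseq_tendsto_atTop_of_not_bddAbove hbA
    obtain ⟨φ₁, W, hφ₁, hW, hconv₁, hconst⟩ :=
      innerLimit_const_caseB_standing hu haxi hE hbdd (tn := tn ∘ ψ) (lamn := lamn ∘ ψ) (rn := rn ∘ ψ)
        (zn := zn ∘ ψ) hT2 (fun k => htn (ψ k)) (fun k => hlam (ψ k)) (hlam0.comp hψ.tendsto_atTop)
        (fun k => hgauge (ψ k)) (hnear.comp hψ.tendsto_atTop) hd
    obtain ⟨ψ₂, hψ₂, hcurl⟩ := zoom_limit_curl_tendsto hu hE hbdd (tn := tn ∘ ψ) (lamn := lamn ∘ ψ)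
      (xn := fun k => EuclideanSpace.single 0 (rn (ψ k)) + EuclideanSpace.single 2 (zn (ψ k))) hT2
      (fun k => htn (ψ k)) (fun k => hlam (ψ k)) (hlam0.comp hψ.tendsto_atTop) (fun k => hgauge (ψ k)) hφ₁ hconv₁
    set φ : ℕ → ℕ := φ₁ ∘ ψ₂ with hφdef
    have hφ : StrictMono φ := hφ₁.comp hψ₂
    have hconv : ∀ s < 0, TendstoLocallyUniformly (fun k => ((lamn ∘ ψ) (φ k) •
        stPull ((lamn ∘ ψ) (φ k) ^ 2) ((lamn ∘ ψ) (φ k)) ((tn ∘ ψ) (φ k))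
          (EuclideanSpace.single 0 (rn (ψ (φ k))) + EuclideanSpace.single 2 (zn (ψ (φ k)))) u) s) (W s) atTop :=
      fun s hs => tendstoLocallyUniformly_subseq (hconv₁ s hs) hψ₂
    have hmild := zoom_limit_oseenIdentity hu hE hbdd (tn := tn ∘ ψ) (lamn := lamn ∘ ψ)
      (xn := fun k => EuclideanSpace.single 0 (rn (ψ k)) + EuclideanSpace.single 2 (zn (ψ k))) hT2
      (fun k => htn (ψ k)) (fun k => hlam (ψ k)) (hlam0.comp hψ.tendsto_atTop) (fun k => hgauge (ψ k)) hφ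
      hW.smooth.continuousOn hconv
    have h1 := caseB_limit_apply_one_eq_zero hT hu haxi hbdd hMₛ (tn := tn ∘ ψ) (lamn := lamn ∘ ψ)
      (rn := rn ∘ ψ) (zn := zn ∘ ψ) hT2 (fun k => htn (ψ k)) (fun k => hlam (ψ k))
      (hlam0.comp hψ.tendsto_atTop) (hnear.comp hψ.tendsto_atTop) hd hφ hconv
    obtain ⟨c, hc1, hc⟩ := innerLimit_unitStream_of_const hW hmild hconst
    have hdist : ∃ D : ℝ, ∀ k, ‖xn (ψ k) -
        (EuclideanSpace.single 0 (rn (ψ k)) + EuclideanSpace.single 2 (zn (ψ k)))‖ ≤ D * (lamn ∘ ψ) k :=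
      ⟨0, fun k => by simp [hxn]⟩
    refine ⟨ψ, fun k => EuclideanSpace.single 0 (rn (ψ k)) + EuclideanSpace.single 2 (zn (ψ k)), φ, W, hψ, hdist,
      hφ, hW, hconv, hmild, hcurl, Or.inl ⟨⟨c, hc1, ?_, hc⟩, fun s hs y => ?_⟩⟩
    · rw [← hc (-1) (by norm_num) 0]
      exact h1 (-1) (by norm_num)
    · have hcs : W s = fun _ => c := funext (hc s hs)
      have h0 : curl (W s) y = 0 := by rw [hcs, curl_eq_curlCLM, fderiv_const_apply, map_zero]
      simpa [h0, hφdef, Function.comp_apply] using hcurl s hs y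

end MasterCoreZoomData

end TypeIIModulationDictionary
end Summit.NavierStokesRegularity.OSWSelfSimilar
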